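import Literature.MathematicalPhysics.QuantumFieldTheory.BalabanImbrieJaffe1984to88.BIJ88Ineq238FlatTorus
import Literature.MathematicalPhysics.QuantumFieldTheory.BalabanImbrieJaffe1984to88.BIJ88Normalization49Of238

/-!
# `BalabanImbrieJaffe1984to88.BIJ88Eq240FlatTorus` — T. Bałaban, J. Imbrie, A. Jaffe, *Effective action and cluster properties of the
abelian Higgs model*, Commun. Math. Phys. **114** (1988) 257–315 [BalabanImbrieJaffe1988], §2 (2.39)–(2.40) p. 264 [PDF 8] and §4
(4.9)–(4.11) p. 275 [PDF 19]: **THE SINGLE-SCALE PROPAGATOR `C^{(k)}_Λ(u)` EXISTS AND THE SCALAR NORMALIZATION FACTOR `Z^{(j)}_{Λ}(u_k)` OF (4.9)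
CONVERGES AT A GENERAL STEP `j = k ≥ 1`, AT EVERY FLAT / PURE-GAUGE BACKGROUND ON THE TORUS** — p. 264 *"by (2.38), C^{(k)}_Λ(u)^{−1}
is bounded below"* made a theorem: the «Poincaré-type input of [I] §7» (p02's hypothesis `hP`, r18's in `posDef_op240_of_238`)
is DISCHARGED at `u_k = 1^{h′}` by p33's flat block Poincaré–Steiner bound, the (2.38)-shape bound is this seat's `ineq238_flat_mult` (or ANY
complex operator satisfying it), and the real-matrix hypotheses of p02's (2.40) file / r18's (4.9) file are met by an explicit REALIFICATION of
the complex Hermitian operators of the Higgs field (r18's type gap (α) of `C2S14-CLOSURE.md` §3 item 6).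

statement-level skeleton of published theorems with citation tags; proofs where landed; nothing here is a claim about the Yang–Mills mass gap

PDF held: `paper:balaban1988-cmp114-bij-abelian-higgs-effective-action` (journal page = PDF page + 256; p. 264 = PDF 8 rendered
`HOME/lit-balaban-p31/renders/original-p008-x2.png`; p. 275 = PDF 19, r18's render `HOME/lit-balaban-r18/renders/c2-p019.png`).

CITATION HEADER (lean-in-tree rule).  lit-balaban cell (HOME `run/shared/lean/pub/lit-balaban/`), Phase 2, seat p31 gen 18 (unit
`lit-balaban-p31`, literature-prover-lit-balaban-p31-g18-0), free-target protocol G.5-34(d), TAKING line HOME/STATUS.md 2026-08-22T20:0xZ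
(stem check: `BIJ88Eq240Existence` = p02's abstract real-matrix model only; courtesy notices to r18, p02, p29).  Rows of
`HOME/lit-balaban-r18/ROWS-C2.md` (owner r18, referee ref-5): **C2.Eq2.39 / C2.Eq2.40** (DEF; typed `BIJ88Sect2Statements.Eq240`, head p02 g3's
`BIJ88Eq240Existence.eq240_of_238` — here INHABITED at flat `u` for complex torus operators, cells only), **C2.Eq4.9** (DEF; r18's
`BIJ88Normalization46.Z49`/`Z49_eq` for `T` positive definite, r18 g7's `BIJ88Normalization49Torus` at `j = 0`, r18 g11's
`BIJ88Normalization49Of238` at the model level — here `T.PosDef` DISCHARGED at `j = k ≥ 1`, flat `u`), C2.Eq2.38 consumer.  Files USED BY NAME,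
nothing restated: p33's `BIJ85BlockKPoincare.sum_norm_sq_le_cov` (the `k`-block Poincaré–Steiner coercivity; here `k = 1`, `u = 1`), p11's/r18 g4's
`BIJ85BlockAveragesTorusK` (`qCovK`, `qCovK_gaugeAct`, `cornerIter`, `blkIter`, `blkIter_cornerIter`, `blockK`), gen 16's
`BIJ88NeumannPropagatorFlatDecay.holCK_flat`, gen 15's `BIJ88DeltaLoc234Torus` (`qMatT`, `qMatT_apply`, `qMatT_mulVec`, `deltaLocT`,
`deltaLocT_conjTranspose`) and `BIJ88NeumannNoZeroModesTorus.IsBlockUnion`, this seat's `BIJ88Ineq238FlatTorus.ineq238_flat_mult` (p339053),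
r18's `BIJ88Sect2Statements.Eq240`, p02's `BIJ88Eq240Existence` (`eq240_unique`), r18's `BIJ88Normalization46` (`Z49`, `Z49_eq`,
`log_Z49_sites`), `BIJ88Normalization49Of238.posDef_of_isSymm_of_pos`, `BIJ88Sect4Statements.Eks` ((4.11)).

## The print (verbatim)

p. 264 (text layer p0008 + ×2 render; v1.1: the paraphrase of v1 replaced by the printed sentences, referee ref-5 D-g58-1): *"Finally, we need
to construct a localized version of C^{(k)}_Λ(Ω, u) = [(Δ_k(Ω, u) + aL^{−2}Q(u)^*Q(u))|_Λ]^{−1}, (2.39) the single-scale propagator for the scalar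
field in the k-th step. We have already replaced Δ_k(Ω, u) with Δ_{k,loc}(u). Let us assume u is smooth in a neighborhood of Λ, the region for the
Dirichlet boundary conditions in (2.39). We define C^{(k)}_Λ(u) = [(Δ_{k,loc}(u) + aL^{−2}Q(u)^*Q(u))|_Λ]^{−1}. (2.40) This is of course a nonlocal
operator, but by (2.38), C^{(k)}_Λ(u)^{−1} is bounded below and a random walk expansion as in [6] can be used to prove that |C^{(k)}_Λ(u; x₁, x₂)| ≦
ce^{−c|x₁−x₂|}. (2.41)"*  p. 275: *"Similarly for
the scalar field we have Z^{(j)}_{Λ₁₀^{(j)}}(u_k) = ∫𝒟φ_{Λ₁₀^{(j)}} exp(−½⟨Λ₁₀^{(j)}φ,(Δ^{L^jη}_{j,loc}(u_k) + aL^{−2}P(u_k))Λ₁₀^{(j)}φ⟩ −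
E^{(j)}_{k,s}|Λ₁₀^{(j)}|), (4.9) with P(u_k) = Q(u_k)^*Q(u_k), (4.10) E^{(j)}_{k,s} = −(d−2)log L^jη. (4.11)"*

## The mechanism and what is proved (theorems + 8 small definitions with bodies; 0 `sorry`; no `Prop`-valued fact; standard axioms)

* §1 **`sum_norm_sq_le_pureGauge`** — THE POINCARÉ-TYPE INPUT AT A PURE GAUGE: on `T^{(k)}` (any level with a next one),
  `Σ_x|φ(x)|² ≤ 2(L−1)L·Σ_b|u(b)φ(b₊) − φ(b₋)|² + 2L^d·Σ_y|(Q(u)φ)(y)|²` for `u = 1^{h′}` and EVERY `φ` — p33's `sum_norm_sq_le_cov` at `u = 1`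
  (no smallness terms, `holCK_flat`) applied to `h′^{−1}φ` and transported by `qCovK_gaugeAct`.
* §2 `pOp u = Q(u)ᴴQ(u)` ((4.10), Gram matrix of gen 15's `qMatT u 1`), `pOp_isHermitian`, `star_dotProduct_pOp_mulVec` (`φᴴPφ = Σ_y|(Q(u)φ)(y)|²`),
  `op240 Δ κ u = Δ + κP(u)`, `re_form_op240`, `op240_isHermitian`.
* §3 `c240 P γ κ = min(γ/(2(L−1)L), κ/(2L^d))` (`c240_pos`), **`lowerBound_op240_flat`**: a (2.38)-SHAPE bound
  `γΣ_b|u(b)φ(b₊)−φ(b₋)|² − E‖φ‖² ≤ Re φᴴΔφ` on the fields supported in `Λ` (`γ ≥ 0`; the conclusion shape of `ineq238_flat_mult`) gives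
  `(c₀ − E)‖φ‖² ≤ Re φᴴ(Δ + κP(u))φ` there; **`re_form_op240_pos`** (strict for `E < c₀`, `φ ≠ 0`) — p02's `lowerBound_of_238` arithmetic with
  `hP` discharged.
* §4 `compress Λ M = M|_Λ` (Dirichlet restriction), `ext0` (extension by zero), `star_dotProduct_compress` (`vᴴM|_Λv = (ext v)ᴴM(ext v)`),
  **`isUnit_compress_of_re_pos`**; `qSq u` = `Q(u)` as an operator on `ℓ²(T^{(k)})` (value at `y` written at the corner point of `B(y)` —
  [I] (2.4) *"y = Ln denotes a corner of a block"*), **`conjTranspose_qSq_mul_qSq`** (`Q̃ᴴQ̃ = P(u)`), `compress_qSq_gram` (on a union `Λ` of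
  blocks `(Q̃|_Λ)ᴴ(Q̃|_Λ) = P(u)|_Λ`), **`eq240_flat`**: p02's `Eq240 a L (Δ|_Λ) (Q̃|_Λ)ᴴ (Q̃|_Λ) C` INHABITED with
  `C = [(Δ + aL^{−2}P(u))|_Λ]^{−1}` for every complex `Δ` with the (2.38)-shape bound and `E < c₀` (uniqueness = p02's `eq240_unique`).
* §5 `cplx`/`realify` (two real coordinates per site; `realify M = [[Re M, −Im M],[Im M, Re M]]`), `cplx_realify_mulVec`,
  **`dotProduct_realify_mulVec`** (`vᵀ·realify M·w = Re φ_vᴴMφ_w`), `realify_isSymm` (Hermitian ⟹ symmetric), **`realify_posDef`**,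
  `card_idx` (`|ι| = 2|Λ|`); **`Z49_flat_eq`** / **`log_Z49_flat_sites`**: for HERMITIAN `Δ` with the (2.38)-shape bound the realified precision matrix
  `T = realify((Δ + κP(u))|_Λ)` of (4.9) is positive definite and r18's closed form / (4.11)-substituted logarithm hold with `T.PosDef` DISCHARGED.
* §6 THE LOCATED MEMBERS FOR GEN 15's `Δ_{k,loc}(1^h)`: **`eq240_deltaLocT_flat`** and **`Z49_deltaLocT_flat`** — under EXACTLY the data
  hypotheses of `ineq238_flat_mult` (read on `Λ`: the (2.35) row hypotheses (i)–(iii) with multiplicity `m` on every block row of `Λ`, every unit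
  bond meeting `Λ` inside `Ω₀^{(k)*}`), `Λ` a union of `L`-blocks of `T^{(k)}`, `k + 1 ≤ m + K`, and the (2.35)-error below the Poincaré constant
  `(A/a_k)a_k²c₁(m·e^{−2δ₀R/L^k} + e^{−(δ₀/2)R₁/L^k}) < c₀((A/a_k)min(a_k/(8d),½), κ)` (true for the printed radii `R, R₁ ~ r(e_k)L^k` once `r(e_k)`
  is large): `Eq240` for `Δ_{k,loc}(1^h)|_Λ` and, for symmetric `λ_α`, `ζ″` (`deltaLocT_conjTranspose`), `T.PosDef ∧ Z49 T E N = e^{−EN}√(2π)^{2|Λ|}/√det T`.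
  (For the printed (2.27)/(2.29) torus data of record — p29's `BIJ88LocWeights227Torus` — §§3–5 apply verbatim to p29's `ineq238_flat_cwt`
  conclusion; nothing of p29's is restated here.)
HONEST SCOPE.  (i) FLAT / PURE-GAUGE BACKGROUNDS ONLY (`u_k = 1^{h′}`): the Poincaré step uses `|u_b − 1| = 0` inside the blocks; a (2.32)-smooth
`u` needs p33's smallness terms and the (7.3.2) field-strength term — not here.  (ii) Counting normalization of gen 15 (`deltaLocT = (A/a_k)×`
printed `Δ_{k,loc}`): the printed `aL^{−2}` is `κ = (A/a_k)aL^{−2}`; `Eq240`'s parameters `(a, L)` are free reals here (any `κ = aL^{−2} ≥ 0`), and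
`C` is `(a_k/A)×` the printed `C^{(k)}_Λ`.  (iii) `Q(u)` enters p02's square-matrix predicate through the corner-point embedding `qSq` (print's
identification of `T^{(k+1)}` with the block corners); the Gram identity `(Q̃|_Λ)ᴴ(Q̃|_Λ) = (Q^*Q)|_Λ` needs `Λ` to be a union of `L`-blocks (as
`Λ₁₀^{(j)}` is).  (iv) (2.41) (decay of `C^{(k)}_Λ`, the random walk expansion) is NOT here (p13's lattice files `BIJ88Decay241Walks` /
`BIJ88Ineq246Lattice` treat it at the operator-model level).  (v) `j = k` (the operator at its own level); the rescaled `Δ^{L^jη}_{j,loc}` bookkeeping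
of (4.9) for `j < k` is r18 g9's `BIJ88Eq411Scaling` and is not repeated.  (vi) `m² = 0`, window `a₋ = a₊ = a`, `1 ≤ k`, `k + 1 ≤ m + K`; constants
not optimized.
Imports: this seat's `BIJ88Ineq238FlatTorus` (→ `BIJ85Ineq732FlatRegion`, gen 17's `BIJ88DeltaLocFlatClose235`, p02's `BIJ88Ineq238Proof`),
r18's `BIJ88Normalization49Of238` (→ `BIJ88Normalization46`, p02's `BIJ88Eq240Existence`).  Literature + Mathlib only.  Unit `lit-balaban-p31`
(literature-prover-lit-balaban-p31-g18-0), 2026-08-22; v1.1 DOC-ONLY (gen 19, literature-prover-lit-balaban-p31-g19-0): p. 264 quotes made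
verbatim (referee ref-5 D-g58-1), no declaration touched.  NOT summit progress.
-/

open scoped BigOperators Matrix ComplexConjugate
open Finset Matrix

namespace Literature.MathematicalPhysics.QuantumFieldTheory.BalabanImbrieJaffe1984to88.BIJ88Eq240FlatTorus

open Literature.MathematicalPhysics.QuantumFieldTheory.Balaban1983to89
open BIJ88Sect3Statements (U1 toC starB mem_starB toC_mul toC_one toC_inv norm_toC)
open BIJ85BlockAveragesTorus BIJ85BlockAveragesTorusK
open BIJ85BlockKPoincare (sum_norm_sq_le_cov)
open BIJ88NeumannNoZeroModesTorus (IsBlockUnion innerK mem_innerK)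
open BIJ88DeltaLoc234Torus (qMatT qMatT_apply qMatT_mulVec deltaLocT deltaRegion deltaLocT_conjTranspose)
open BIJ88NeumannPropagatorFlatDecay (holCK_flat)
open BIJ88Sect2Statements (Eq240)
open BIJ88Eq240Existence (eq240_unique)
open BIJ88Normalization46 (Z49 Z49_eq Z49_pos log_Z49 log_Z49_sites)
open BIJ88Normalization49Of238 (posDef_of_isSymm_of_pos)
open GaugeField (gaugeAct)

noncomputable section

variable {P : Params} {j : ℕ}

/-! ## §1 The one-step flat Poincaré–coercivity at a pure gauge: the «Poincaré-type input» of p. 264 DISCHARGED at `u_k = 1^{h′}` -/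

section Poincare

/-- kernel: at a pure gauge the covariant bond difference is the plain difference of the gauged-away field:
`|h′(b₋)h′(b₊)^{−1}(h′ψ)(b₊) − (h′ψ)(b₋)| = |ψ(b₊) − ψ(b₋)|`. [cite: BalabanImbrieJaffe1985, (2.8) p.303] -/
private theorem norm_bond_gauge (h' : GaugeTransf P j U1) (ψ : Balaban1983to89.Site P j → ℂ) (b : PBond P j) :
    ‖toC (h' b.src) * (toC (h' b.tgt))⁻¹ * (toC (h' b.tgt) * ψ b.tgt) - toC (h' b.src) * ψ b.src‖ = ‖ψ b.tgt - ψ b.src‖ := by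
  have hz := toC_ne_zero (h' b.tgt)
  rw [show toC (h' b.src) * (toC (h' b.tgt))⁻¹ * (toC (h' b.tgt) * ψ b.tgt) - toC (h' b.src) * ψ b.src
      = toC (h' b.src) * (ψ b.tgt - ψ b.src) by field_simp, norm_mul, norm_toC, one_mul]

/-- **THE POINCARÉ-TYPE INPUT OF p. 264 AT A PURE GAUGE** (*"by (2.38), C^{(k)}_Λ(u)^{−1} is bounded below"* — the
silent [I] §7 / [7] step, p02's hypothesis `hP` of `eq240_of_238`): on the unit lattice `T^{(k)}` (any level `j` with `j + 1 ≤ m + K`), for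
the pure-gauge bond field `u = 1^{h′}` and EVERY field `φ`,
`Σ_x|φ(x)|² ≤ 2(L−1)L·Σ_b|u(b)φ(b₊) − φ(b₋)|² + 2L^d·Σ_y|(Q(u)φ)(y)|²`, `u(b) = h′(b₋)h′(b₊)^{−1}`, `Q(u)` the one-step covariant average
(2.6) — p33's `k`-block Poincaré–Steiner coercivity `sum_norm_sq_le_cov` at `u = 1` (`k = 1`, no smallness terms) transported by p11's gauge
covariance `qCovK_gaugeAct`. [cite: BalabanImbrieJaffe1985, (7.3.2) p.326] -/
theorem sum_norm_sq_le_pureGauge (hj : j + 1 ≤ P.m + P.K) (h' : GaugeTransf P j U1) (φ : Balaban1983to89.Site P j → ℂ) :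
    ∑ x, ‖φ x‖ ^ 2 ≤
      2 * (((P.L : ℝ) - 1) * P.L) * ∑ b : PBond P j, ‖toC (h' b.src) * (toC (h' b.tgt))⁻¹ * φ b.tgt - φ b.src‖ ^ 2
        + 2 * (P.L : ℝ) ^ P.d * ∑ y, ‖qCovK (gaugeAct h' (1 : GaugeField P j U1)) 1 φ y‖ ^ 2 := by
  set ψ : Balaban1983to89.Site P j → ℂ := fun x => (toC (h' x))⁻¹ * φ x with hψ
  have hφψ : φ = fun x => toC (h' x) * ψ x := by
    funext x; rw [hψ]; field_simp [toC_ne_zero (h' x)]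
  have h := sum_norm_sq_le_cov (k := 1) hj (1 : GaugeField P j U1) (T := 0) (δ := 0)
    (fun b _ => by rw [show toC ((1 : GaugeField P j U1) b) = 1 from toC_one, sub_self, norm_zero])
    (fun x => by rw [holCK_flat hj x, sub_self, norm_zero]) ψ
  simp only [pow_one, one_mul, mul_zero, zero_pow two_ne_zero, add_zero, sub_zero] at h
  have e1 : ∑ x, ‖ψ x‖ ^ 2 = ∑ x, ‖φ x‖ ^ 2 :=
    sum_congr rfl fun x _ => by rw [hψ, norm_mul, norm_inv, norm_toC, inv_one, one_mul]
  have e2 : ∑ b : PBond P j, ‖toC ((1 : GaugeField P j U1) b) * ψ b.tgt - ψ b.src‖ ^ 2 =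
      ∑ b : PBond P j, ‖toC (h' b.src) * (toC (h' b.tgt))⁻¹ * φ b.tgt - φ b.src‖ ^ 2 :=
    sum_congr rfl fun b _ => by
      rw [show toC ((1 : GaugeField P j U1) b) = 1 from toC_one, one_mul, hφψ, norm_bond_gauge]
  have e3 : ∑ y, ‖qCovK (1 : GaugeField P j U1) 1 ψ y‖ ^ 2 = ∑ y, ‖qCovK (gaugeAct h' (1 : GaugeField P j U1)) 1 φ y‖ ^ 2 :=
    sum_congr rfl fun y _ => by
      rw [hφψ, qCovK_gaugeAct h' 1 ψ 1 hj y, norm_mul, norm_toC, one_mul]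
  rw [e1, e2, e3] at h
  exact h

end Poincare

/-! ## §2 `P(u) = Q(u)^*Q(u)` ((4.10)) on the unit lattice, the operator `Δ + κP(u)` of (2.39)/(2.40) and its quadratic form -/

section Forms

variable {S T : Type*} [Fintype S] [Fintype T]

/-- kernel: `vᴴv = Σ_i ‖v_i‖²`. [folklore] -/
private theorem star_dotProduct_self (v : S → ℂ) : star v ⬝ᵥ v = ((∑ i, ‖v i‖ ^ 2 : ℝ) : ℂ) := by
  simp only [dotProduct, Pi.star_apply, Complex.ofReal_sum, Complex.ofReal_pow]
  refine Finset.sum_congr rfl fun i _ => ?_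
  rw [Complex.star_def, ← Complex.normSq_eq_conj_mul_self, Complex.normSq_eq_norm_sq, Complex.ofReal_pow]

/-- kernel: adjointness, `ψᴴ(Qv) = (Qᴴψ)ᴴv`. [folklore] -/
private theorem star_dotProduct_mulVec (Q : Matrix T S ℂ) (ψ : T → ℂ) (v : S → ℂ) :
    star ψ ⬝ᵥ (Q *ᵥ v) = star (Qᴴ *ᵥ ψ) ⬝ᵥ v := by
  rw [dotProduct_mulVec, star_mulVec, conjTranspose_conjTranspose]

/-- kernel: `φᴴ(AᴴA)φ = Σ_y |(Aφ)(y)|²`. [folklore] -/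
private theorem star_dotProduct_gram_mulVec (A : Matrix T S ℂ) (φ : S → ℂ) :
    star φ ⬝ᵥ ((Aᴴ * A) *ᵥ φ) = ((∑ y, ‖(A *ᵥ φ) y‖ ^ 2 : ℝ) : ℂ) := by
  rw [← mulVec_mulVec, ← conjTranspose_conjTranspose A, star_dotProduct_mulVec, conjTranspose_conjTranspose,
    conjTranspose_conjTranspose, star_dotProduct_self]

end Forms

section Op240

/-- **`P(u) = Q(u)^*Q(u)`** ((4.10) p. 275; the `aL^{−2}Q(u)^*Q(u)` term of (2.39)/(2.40) p. 264) on the unit lattice `T^{(k)}` (any level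
`j`): the Gram matrix of the one-step covariant block average `Q(u) : ℓ²(T^{(k)}) → ℓ²(T^{(k+1)})` (gen 15's matrix `qMatT u 1` of p11's
`qCovK u 1`). [cite: BalabanImbrieJaffe1988, (4.10) p.275] -/
def pOp (U : GaugeField P j U1) : Matrix (Balaban1983to89.Site P j) (Balaban1983to89.Site P j) ℂ := (qMatT U 1)ᴴ * qMatT U 1

/-- `P(u)` is Hermitian. [cite: BalabanImbrieJaffe1988, (4.10) p.275] -/
theorem pOp_isHermitian (U : GaugeField P j U1) : (pOp U).IsHermitian := isHermitian_conjTranspose_mul_self _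

/-- kernel: **`φᴴP(u)φ = ‖Q(u)φ‖² = Σ_y|(Q(u)φ)(y)|²`**. [cite: BalabanImbrieJaffe1988, (4.10) p.275] -/
theorem star_dotProduct_pOp_mulVec (U : GaugeField P j U1) (φ : Balaban1983to89.Site P j → ℂ) :
    star φ ⬝ᵥ (pOp U *ᵥ φ) = ((∑ y, ‖qCovK U 1 φ y‖ ^ 2 : ℝ) : ℂ) := by
  rw [pOp, star_dotProduct_gram_mulVec]
  congr 1
  exact sum_congr rfl fun y _ => by rw [qMatT_mulVec]

/-- **The operator of (2.39)/(2.40)**: `Δ + κP(u)` on `ℓ²(T^{(k)})` (print: `κ = aL^{−2}`; in gen 15's counting normalization of `Δ_{k,loc}`,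
`deltaLocT = (A/a_k)·Δ^{print}_{k,loc}`, the printed coefficient reads `κ = (A/a_k)·aL^{−2}`). [cite: BalabanImbrieJaffe1988, (2.40) p.264] -/
def op240 (Δ : Matrix (Balaban1983to89.Site P j) (Balaban1983to89.Site P j) ℂ) (κ : ℝ) (U : GaugeField P j U1) :
    Matrix (Balaban1983to89.Site P j) (Balaban1983to89.Site P j) ℂ := Δ + (κ : ℂ) • pOp U

/-- kernel: the quadratic form of `Δ + κP(u)`: `Re φᴴ(Δ + κP)φ = Re φᴴΔφ + κΣ_y|(Q(u)φ)(y)|²`. [cite: BalabanImbrieJaffe1988, (2.40) p.264] -/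
theorem re_form_op240 (Δ : Matrix (Balaban1983to89.Site P j) (Balaban1983to89.Site P j) ℂ) (κ : ℝ) (U : GaugeField P j U1)
    (φ : Balaban1983to89.Site P j → ℂ) :
    (star φ ⬝ᵥ (op240 Δ κ U *ᵥ φ)).re = (star φ ⬝ᵥ (Δ *ᵥ φ)).re + κ * ∑ y, ‖qCovK U 1 φ y‖ ^ 2 := by
  rw [op240, add_mulVec, dotProduct_add, Complex.add_re, smul_mulVec, dotProduct_smul, star_dotProduct_pOp_mulVec, smul_eq_mul,
    ← Complex.ofReal_mul, Complex.ofReal_re]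

/-- `Δ + κP(u)` is Hermitian when `Δ` is. [cite: BalabanImbrieJaffe1988, (2.40) p.264] -/
theorem op240_isHermitian {Δ : Matrix (Balaban1983to89.Site P j) (Balaban1983to89.Site P j) ℂ} (hΔ : Δ.IsHermitian) (κ : ℝ)
    (U : GaugeField P j U1) : (op240 Δ κ U).IsHermitian := by
  have hP := (pOp_isHermitian U).eq
  have hD := hΔ.eq
  show (op240 Δ κ U)ᴴ = op240 Δ κ U
  rw [op240, conjTranspose_add, conjTranspose_smul, hP, hD, Complex.star_def, Complex.conj_ofReal]

end Op240

/-! ## §3 **The p. 264 lower bound at flat `u`**: a (2.38)-shape bound on the fields supported in `Λ` and the flat Poincaré step give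
`Re φᴴ(Δ + κP(u))φ ≥ (c₀ − E)‖φ‖²` — *"by (2.38), C^{(k)}_Λ(u)^{−1} is bounded below"* -/

section LowerBound

/-- the Poincaré constant of §1 combined with the two coefficients: `c₀(γ, κ) = min(γ/(2(L−1)L), κ/(2L^d))`.
[cite: BalabanImbrieJaffe1988, (2.40) p.264] -/
def c240 (P : Params) (γ κ : ℝ) : ℝ := min (γ / (2 * (((P.L : ℝ) - 1) * P.L))) (κ / (2 * (P.L : ℝ) ^ P.d))

/-- kernel: `c₀ > 0` for `γ, κ > 0`. [cite: BalabanImbrieJaffe1988, (2.40) p.264] -/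
theorem c240_pos (P : Params) {γ κ : ℝ} (hγ : 0 < γ) (hκ : 0 < κ) : 0 < c240 P γ κ := by
  have hL2 : 2 ≤ P.L := P.hL.2
  have hL : (2 : ℝ) ≤ P.L := by exact_mod_cast hL2
  have h1 : (0 : ℝ) < 2 * (((P.L : ℝ) - 1) * P.L) := by nlinarith
  have h2 : (0 : ℝ) < 2 * (P.L : ℝ) ^ P.d := by positivity
  exact lt_min (div_pos hγ h1) (div_pos hκ h2)

/-- **THE LOWER BOUND OF p. 264 AT A PURE GAUGE** (*"by (2.38), C^{(k)}_Λ(u)^{−1} is bounded below"*): if a complex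
operator `Δ` on `ℓ²(T^{(k)})` satisfies the (2.38)-SHAPE bound `γ·Σ_b|u(b)φ(b₊) − φ(b₋)|² − E·‖φ‖² ≤ Re φᴴΔφ` for every `φ` supported in
`Λ` (`u = 1^{h′}`; the conclusion shape of `BIJ88Ineq238FlatTorus.ineq238_flat_mult`), then for those `φ`
`(c₀(γ,κ) − E)·‖φ‖² ≤ Re φᴴ(Δ + κP(u))φ` — by §1's Poincaré step `‖φ‖² ≤ 2(L−1)L·Σ_b|…|² + 2L^d‖Q(u)φ‖²`. (p02's `lowerBound_of_238` is the
same arithmetic at the real-matrix level with the Poincaré step as hypothesis `hP`.) [cite: BalabanImbrieJaffe1988, (2.40) p.264] -/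
theorem lowerBound_op240_flat (hj : j + 1 ≤ P.m + P.K) (h' : GaugeTransf P j U1)
    {Δ : Matrix (Balaban1983to89.Site P j) (Balaban1983to89.Site P j) ℂ} {Λ : Finset (Balaban1983to89.Site P j)} {γ E κ : ℝ}
    (hγ : 0 ≤ γ) (hκ : 0 ≤ κ)
    (h238 : ∀ φ : Balaban1983to89.Site P j → ℂ, (∀ x ∉ Λ, φ x = 0) →
      γ * ∑ b : PBond P j, ‖toC (h' b.src) * (toC (h' b.tgt))⁻¹ * φ b.tgt - φ b.src‖ ^ 2 - E * ∑ x, ‖φ x‖ ^ 2 ≤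
        (star φ ⬝ᵥ (Δ *ᵥ φ)).re)
    (φ : Balaban1983to89.Site P j → ℂ) (hφ : ∀ x ∉ Λ, φ x = 0) :
    (c240 P γ κ - E) * ∑ x, ‖φ x‖ ^ 2 ≤ (star φ ⬝ᵥ (op240 Δ κ (gaugeAct h' (1 : GaugeField P j U1)) *ᵥ φ)).re := by
  have hL2 : 2 ≤ P.L := P.hL.2
  have hL : (2 : ℝ) ≤ P.L := by exact_mod_cast hL2
  have hA : (0 : ℝ) < 2 * (((P.L : ℝ) - 1) * P.L) := by nlinarith
  have hB : (0 : ℝ) < 2 * (P.L : ℝ) ^ P.d := by positivity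
  set Bf := ∑ b : PBond P j, ‖toC (h' b.src) * (toC (h' b.tgt))⁻¹ * φ b.tgt - φ b.src‖ ^ 2 with hBf
  set Qf := ∑ y, ‖qCovK (gaugeAct h' (1 : GaugeField P j U1)) 1 φ y‖ ^ 2 with hQf
  set N2 := ∑ x, ‖φ x‖ ^ 2 with hN2
  have hBf0 : 0 ≤ Bf := by rw [hBf]; positivity
  have hQf0 : 0 ≤ Qf := by rw [hQf]; positivity
  have hP := sum_norm_sq_le_pureGauge hj h' φ
  rw [← hBf, ← hQf, ← hN2] at hP
  rw [re_form_op240, ← hQf]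
  have h1 := h238 φ hφ
  rw [← hBf, ← hN2] at h1
  -- c₀‖φ‖² ≤ γ·Bf + κ·Qf
  have hc1 : c240 P γ κ ≤ γ / (2 * (((P.L : ℝ) - 1) * P.L)) := min_le_left _ _
  have hc2 : c240 P γ κ ≤ κ / (2 * (P.L : ℝ) ^ P.d) := min_le_right _ _
  have hc0 : 0 ≤ c240 P γ κ := le_min (div_nonneg hγ hA.le) (div_nonneg hκ hB.le)
  have key : c240 P γ κ * N2 ≤ γ * Bf + κ * Qf := by
    calc c240 P γ κ * N2 ≤ c240 P γ κ * (2 * (((P.L : ℝ) - 1) * P.L) * Bf + 2 * (P.L : ℝ) ^ P.d * Qf) :=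
          mul_le_mul_of_nonneg_left hP hc0
      _ = c240 P γ κ * (2 * (((P.L : ℝ) - 1) * P.L)) * Bf + c240 P γ κ * (2 * (P.L : ℝ) ^ P.d) * Qf := by ring
      _ ≤ γ / (2 * (((P.L : ℝ) - 1) * P.L)) * (2 * (((P.L : ℝ) - 1) * P.L)) * Bf + κ / (2 * (P.L : ℝ) ^ P.d) * (2 * (P.L : ℝ) ^ P.d) * Qf :=
          add_le_add (mul_le_mul_of_nonneg_right (mul_le_mul_of_nonneg_right hc1 hA.le) hBf0)
            (mul_le_mul_of_nonneg_right (mul_le_mul_of_nonneg_right hc2 hB.le) hQf0)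
      _ = γ * Bf + κ * Qf := by rw [div_mul_cancel₀ _ hA.ne', div_mul_cancel₀ _ hB.ne']
  nlinarith

/-- **Strict positivity**: with `E < c₀(γ, κ)` the form of `Δ + κP(u)` is STRICTLY positive on the nonzero fields supported in `Λ` — the
hypothesis *"c·e_k²p(e_k)² < c₁"* of p02's `eq240_of_238`, here with the explicit flat Poincaré constant. [cite: BalabanImbrieJaffe1988, (2.40) p.264] -/
theorem re_form_op240_pos (hj : j + 1 ≤ P.m + P.K) (h' : GaugeTransf P j U1)
    {Δ : Matrix (Balaban1983to89.Site P j) (Balaban1983to89.Site P j) ℂ} {Λ : Finset (Balaban1983to89.Site P j)} {γ E κ : ℝ}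
    (hγ : 0 ≤ γ) (hκ : 0 ≤ κ) (hE : E < c240 P γ κ)
    (h238 : ∀ φ : Balaban1983to89.Site P j → ℂ, (∀ x ∉ Λ, φ x = 0) →
      γ * ∑ b : PBond P j, ‖toC (h' b.src) * (toC (h' b.tgt))⁻¹ * φ b.tgt - φ b.src‖ ^ 2 - E * ∑ x, ‖φ x‖ ^ 2 ≤
        (star φ ⬝ᵥ (Δ *ᵥ φ)).re)
    {φ : Balaban1983to89.Site P j → ℂ} (hφ : ∀ x ∉ Λ, φ x = 0) (hne : φ ≠ 0) :
    0 < (star φ ⬝ᵥ (op240 Δ κ (gaugeAct h' (1 : GaugeField P j U1)) *ᵥ φ)).re := by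
  have h := lowerBound_op240_flat hj h' hγ hκ h238 φ hφ
  have hpos : 0 < ∑ x, ‖φ x‖ ^ 2 := by
    obtain ⟨x, hx⟩ : ∃ x, φ x ≠ 0 := by
      by_contra hh; push Not at hh; exact hne (funext hh)
    exact lt_of_lt_of_le (by positivity : 0 < ‖φ x‖ ^ 2) (single_le_sum (f := fun x => ‖φ x‖ ^ 2) (fun _ _ => by positivity) (mem_univ x))
  nlinarith

end LowerBound

/-! ## §4 Restriction to `Λ` ("`|_Λ`", Dirichlet), existence and uniqueness of `C^{(k)}_Λ(1^{h′})` — p02's `Eq240` INHABITED -/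

section Compress

variable {S : Type*} [Fintype S] [DecidableEq S]

/-- The restriction `M|_Λ` of an operator to the fields supported in `Λ` (the `|_Λ` of (2.39)/(2.40): Dirichlet boundary condition).
[cite: BalabanImbrieJaffe1988, (2.39) p.264] -/
def compress (Λ : Finset S) (M : Matrix S S ℂ) : Matrix ↥Λ ↥Λ ℂ := M.submatrix Subtype.val Subtype.val

/-- extension by zero of a field on `Λ` to the whole lattice. [cite: BalabanImbrieJaffe1988, (2.39) p.264] -/
def ext0 (Λ : Finset S) (v : ↥Λ → ℂ) : S → ℂ := fun x => if hx : x ∈ Λ then v ⟨x, hx⟩ else 0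

omit [Fintype S] in
/-- kernel: the extension vanishes off `Λ`. [cite: BalabanImbrieJaffe1988, (2.39) p.264] -/
theorem ext0_of_not_mem {Λ : Finset S} (v : ↥Λ → ℂ) {x : S} (hx : x ∉ Λ) : ext0 Λ v x = 0 := by
  rw [ext0, dif_neg hx]

omit [Fintype S] in
/-- kernel: the extension on `Λ`. [cite: BalabanImbrieJaffe1988, (2.39) p.264] -/
theorem ext0_coe {Λ : Finset S} (v : ↥Λ → ℂ) (x : ↥Λ) : ext0 Λ v x = v x := by
  rw [ext0, dif_pos x.2]

omit [Fintype S] in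
/-- kernel: the extension is injective. [cite: BalabanImbrieJaffe1988, (2.39) p.264] -/
theorem ext0_eq_zero_iff {Λ : Finset S} (v : ↥Λ → ℂ) : ext0 Λ v = 0 ↔ v = 0 := by
  constructor
  · intro h; funext x; have := congrFun h x; rwa [ext0_coe] at this
  · intro h; funext x; rw [h]; unfold ext0; split_ifs <;> rfl

omit [Fintype S] [DecidableEq S] in
/-- kernel: a sum over the lattice of a function vanishing off `Λ` is the sum over `Λ` as a type. [folklore] -/
private theorem sum_eq_sum_coe [Fintype S] {Λ : Finset S} {f : S → ℂ} (hf : ∀ x ∉ Λ, f x = 0) : ∑ x, f x = ∑ x : ↥Λ, f x := by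
  rw [Finset.sum_coe_sort Λ f]
  exact (Finset.sum_subset (Finset.subset_univ Λ) fun x _ hx => hf x hx).symm

/-- kernel: `(M ext0 v)(x) = (M|_Λ v)(x)` for `x ∈ Λ`. [cite: BalabanImbrieJaffe1988, (2.39) p.264] -/
theorem mulVec_ext0_coe {Λ : Finset S} (M : Matrix S S ℂ) (v : ↥Λ → ℂ) (x : ↥Λ) :
    (M *ᵥ ext0 Λ v) x = (compress Λ M *ᵥ v) x := by
  simp only [mulVec, dotProduct, compress, submatrix_apply]
  rw [sum_eq_sum_coe (Λ := Λ) (fun y hy => by rw [ext0_of_not_mem v hy, mul_zero])]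
  exact sum_congr rfl fun y _ => by rw [ext0_coe]

/-- **The quadratic form of `M|_Λ` is the form of `M` on the fields supported in `Λ`**: `vᴴ(M|_Λ)v = (ext v)ᴴM(ext v)`.
[cite: BalabanImbrieJaffe1988, (2.39) p.264] -/
theorem star_dotProduct_compress (Λ : Finset S) (M : Matrix S S ℂ) (v : ↥Λ → ℂ) :
    star v ⬝ᵥ (compress Λ M *ᵥ v) = star (ext0 Λ v) ⬝ᵥ (M *ᵥ ext0 Λ v) := by
  simp only [dotProduct, Pi.star_apply]
  rw [sum_eq_sum_coe (Λ := Λ) (fun y hy => by rw [ext0_of_not_mem v hy, star_zero, zero_mul])]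
  exact sum_congr rfl fun x _ => by rw [ext0_coe, mulVec_ext0_coe]

/-- **Existence on the finite lattice `Λ`**: if `Re φᴴMφ > 0` for every nonzero `φ` supported in `Λ`, then `M|_Λ` is invertible (it is
injective). [cite: BalabanImbrieJaffe1988, (2.40)–(2.41) p.264] -/
theorem isUnit_compress_of_re_pos {Λ : Finset S} {M : Matrix S S ℂ}
    (hpos : ∀ φ : S → ℂ, (∀ x ∉ Λ, φ x = 0) → φ ≠ 0 → 0 < (star φ ⬝ᵥ (M *ᵥ φ)).re) : IsUnit (compress Λ M) := by
  rw [← Matrix.mulVec_injective_iff_isUnit]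
  intro v w h
  by_contra hne
  have hvw : v - w ≠ 0 := sub_ne_zero.2 hne
  have h1 := hpos (ext0 Λ (v - w)) (fun x hx => ext0_of_not_mem _ hx) (fun h0 => hvw ((ext0_eq_zero_iff _).1 h0))
  rw [← star_dotProduct_compress, mulVec_sub, h, sub_self, dotProduct_zero, Complex.zero_re] at h1
  exact lt_irrefl _ h1

end Compress

section CornerEmbedding

/-- **`Q(u)` as an operator on `ℓ²(T^{(k)})`**: the value `(Q(u)φ)(y)` written at the corner point of the block `B(y)`, zero rows at the other
points (*"Imbed the unit lattice in an L-lattice of blocks B(y). Here y = Ln denotes a corner of a block"*, [I] (2.4) p. 302: the coarse lattice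
IS the set of block corners). [cite: BalabanImbrieJaffe1985, (2.4) p.302] -/
def qSq (U : GaugeField P j U1) : Matrix (Balaban1983to89.Site P j) (Balaban1983to89.Site P j) ℂ :=
  Matrix.of fun x x' => if cornerIter 1 (blkIter 1 x) = x then qMatT U 1 (blkIter 1 x) x' else 0

/-- kernel: the block corners are exactly the image of the coarse lattice under `cornerIter 1`. [cite: BalabanImbrieJaffe1985, (2.4) p.302] -/
theorem corner_iff_mem_image (hj : j + 1 ≤ P.m + P.K) (x : Balaban1983to89.Site P j) :
    cornerIter 1 (blkIter 1 x) = x ↔ x ∈ (univ : Finset (Balaban1983to89.Site P (j + 1))).image (cornerIter 1) := by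
  rw [mem_image]
  constructor
  · intro h; exact ⟨blkIter 1 x, mem_univ _, h⟩
  · rintro ⟨z, -, rfl⟩; rw [blkIter_cornerIter 1 hj z]

/-- **`Q̃ᴴQ̃ = Q^*Q = P(u)`**: summing over the corner points is summing over the coarse lattice. [cite: BalabanImbrieJaffe1988, (4.10) p.275] -/
theorem conjTranspose_qSq_mul_qSq (hj : j + 1 ≤ P.m + P.K) (U : GaugeField P j U1) : (qSq U)ᴴ * qSq U = pOp U := by
  ext x₁ x₂
  rw [pOp, mul_apply, mul_apply]
  have hinj : Set.InjOn (cornerIter 1 : Balaban1983to89.Site P (j + 1) → Balaban1983to89.Site P j)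
      ((univ : Finset (Balaban1983to89.Site P (j + 1))) : Set (Balaban1983to89.Site P (j + 1))) :=
    fun z _ z' _ h => by rw [← blkIter_cornerIter 1 hj z, h, blkIter_cornerIter 1 hj z']
  -- restrict the sum to the corners, then reindex by the coarse lattice
  rw [← sum_subset (subset_univ ((univ : Finset (Balaban1983to89.Site P (j + 1))).image (cornerIter 1)))
    (fun x _ hx => by
      have hc : ¬ cornerIter 1 (blkIter 1 x) = x := fun h => hx ((corner_iff_mem_image hj x).1 h)
      rw [qSq, of_apply, if_neg hc, mul_zero]),
    sum_image hinj]
  refine sum_congr rfl fun z _ => ?_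
  rw [conjTranspose_apply, conjTranspose_apply, qSq, of_apply, of_apply, blkIter_cornerIter 1 hj z, if_pos rfl, if_pos rfl]

/-- kernel: `Q̃(x, x′) ≠ 0` forces `x` to be the corner of the block of `x′`. [cite: BalabanImbrieJaffe1985, (2.4)–(2.6) p.302] -/
theorem qSq_ne_zero {U : GaugeField P j U1} {x x' : Balaban1983to89.Site P j} (h : qSq U x x' ≠ 0) :
    cornerIter 1 (blkIter 1 x) = x ∧ blkIter 1 x' = blkIter 1 x := by
  rw [qSq, of_apply] at h
  by_cases hc : cornerIter 1 (blkIter 1 x) = x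
  · rw [if_pos hc, qMatT_apply] at h
    by_cases hb : x' ∈ blockK 1 (blkIter 1 x)
    · exact ⟨hc, mem_blockK.1 hb⟩
    · rw [if_neg hb] at h; exact absurd rfl h
  · rw [if_neg hc] at h; exact absurd rfl h

/-- **On a union `Λ` of blocks the restriction commutes with the product**: `(Q̃|_Λ)ᴴ(Q̃|_Λ) = (Q̃ᴴQ̃)|_Λ = P(u)|_Λ` — the corner of the block
of a point of `Λ` lies in `Λ`. [cite: BalabanImbrieJaffe1988, (2.40) p.264] -/
theorem compress_qSq_gram (hj : j + 1 ≤ P.m + P.K) (U : GaugeField P j U1) {Λ : Finset (Balaban1983to89.Site P j)} (hΛ : IsBlockUnion 1 Λ) :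
    compress Λ (qSq U)ᴴ * compress Λ (qSq U) = compress Λ (pOp U) := by
  rw [← conjTranspose_qSq_mul_qSq hj U]
  ext y₁ y₂
  simp only [compress, mul_apply, submatrix_apply, conjTranspose_apply]
  rw [Finset.sum_coe_sort Λ (fun x => star (qSq U x y₁.1) * qSq U x y₂.1)]
  refine sum_subset (subset_univ Λ) fun x _ hx => ?_
  by_cases h0 : qSq U x y₁.1 = 0
  · rw [h0, star_zero, zero_mul]
  · exfalso
    obtain ⟨hc, hb⟩ := qSq_ne_zero h0
    apply hx
    have hmem : x ∈ blockK 1 (blkIter 1 (y₁ : Balaban1983to89.Site P j)) := by rw [mem_blockK, hb]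
    exact hΛ _ y₁.2 hmem

/-- **(2.39)/(2.40) AT FLAT `u`: THE PROPAGATOR `C^{(k)}_Λ(1^{h′})` EXISTS AND IS UNIQUE** — p02's `Eq240` INHABITED in the algebra of
operators on `ℓ²(Λ)` (`Λ` a union of blocks of `T^{(k)}`): for any complex `Δ` with the (2.38)-shape bound on the fields supported in `Λ`
(`γ ≥ 0`), `κ = aL^{−2} ≥ 0` and (2.35)-error `E < c₀(γ, κ)`, `C := [(Δ + aL^{−2}Q^*Q)|_Λ]^{−1}` satisfies `C·(Δ|_Λ + aL^{−2}(Q̃|_Λ)^*(Q̃|_Λ)) = 1 =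
(…)·C`; by p02's `eq240_unique` it is the only such operator. [cite: BalabanImbrieJaffe1988, (2.40) p.264] -/
theorem eq240_flat (hj : j + 1 ≤ P.m + P.K) (h' : GaugeTransf P j U1)
    {Δ : Matrix (Balaban1983to89.Site P j) (Balaban1983to89.Site P j) ℂ} {Λ : Finset (Balaban1983to89.Site P j)} (hΛ : IsBlockUnion 1 Λ)
    {γ E a L : ℝ} (hγ : 0 ≤ γ) (hκ : 0 ≤ a * L ^ (-(2 : ℤ))) (hE : E < c240 P γ (a * L ^ (-(2 : ℤ))))
    (h238 : ∀ φ : Balaban1983to89.Site P j → ℂ, (∀ x ∉ Λ, φ x = 0) →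
      γ * ∑ b : PBond P j, ‖toC (h' b.src) * (toC (h' b.tgt))⁻¹ * φ b.tgt - φ b.src‖ ^ 2 - E * ∑ x, ‖φ x‖ ^ 2 ≤
        (star φ ⬝ᵥ (Δ *ᵥ φ)).re) :
    Eq240 a L (compress Λ Δ) (compress Λ (qSq (gaugeAct h' (1 : GaugeField P j U1)))ᴴ)
      (compress Λ (qSq (gaugeAct h' (1 : GaugeField P j U1))))
      (compress Λ (op240 Δ (a * L ^ (-(2 : ℤ))) (gaugeAct h' (1 : GaugeField P j U1))))⁻¹ := by
  set U : GaugeField P j U1 := gaugeAct h' 1 with hU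
  have hM : compress Λ Δ + algebraMap ℝ (Matrix ↥Λ ↥Λ ℂ) (a * L ^ (-(2 : ℤ))) * (compress Λ (qSq U)ᴴ * compress Λ (qSq U)) =
      compress Λ (op240 Δ (a * L ^ (-(2 : ℤ))) U) := by
    rw [compress_qSq_gram hj U hΛ, Algebra.algebraMap_eq_smul_one, smul_mul_assoc, one_mul, op240, compress, compress, compress,
      submatrix_add, submatrix_smul]
    rfl
  have hunit : IsUnit (compress Λ (op240 Δ (a * L ^ (-(2 : ℤ))) U)) :=
    isUnit_compress_of_re_pos fun φ hφ hne => re_form_op240_pos hj h' hγ hκ hE h238 hφ hne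
  have hdet := (Matrix.isUnit_iff_isUnit_det _).1 hunit
  refine ⟨?_, ?_⟩
  · rw [hM]; exact Matrix.nonsing_inv_mul _ hdet
  · rw [hM]; exact Matrix.mul_nonsing_inv _ hdet

end CornerEmbedding

/-! ## §5 Real coordinates (two per site): the realified precision matrix of (4.9) and r18's `Z49_eq` with `T.PosDef` DISCHARGED -/

section Realify

variable {ι : Type*} [Fintype ι]

/-- the complex field with real coordinates `v`: `φ_v(i) = v(i,0) + i·v(i,1)` (the `𝒟φ` of (4.9) is Lebesgue measure in these coordinates,
two per site; r18's `BIJ88Normalization49Torus.ofR` on a general index type). [cite: BalabanImbrieJaffe1988, (4.9) p.275] -/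
def cplx (v : ι × Fin 2 → ℝ) : ι → ℂ := fun i => ⟨v (i, 0), v (i, 1)⟩

omit [Fintype ι] in
/-- kernel: `φ_v = 0 ↔ v = 0`. [cite: BalabanImbrieJaffe1988, (4.9) p.275] -/
theorem cplx_eq_zero_iff (v : ι × Fin 2 → ℝ) : cplx v = 0 ↔ v = 0 := by
  constructor
  · intro h
    funext p
    obtain ⟨i, a⟩ := p
    have hi := congrFun h i
    rw [cplx, Pi.zero_apply, Complex.ext_iff] at hi
    simp only [Complex.zero_re, Complex.zero_im] at hi
    fin_cases a
    · exact hi.1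
    · exact hi.2
  · intro h; funext i; rw [h]; rfl

/-- **The REALIFICATION of a complex operator**: the real `2|ι| × 2|ι|` matrix `[[Re M, −Im M], [Im M, Re M]]` of `φ ↦ Mφ` in the coordinates
`cplx` — the "T" of r18's `BIJ88Normalization46.Z49` for a complex precision operator. [cite: BalabanImbrieJaffe1988, (4.9) p.275] -/
def realify (M : Matrix ι ι ℂ) : Matrix (ι × Fin 2) (ι × Fin 2) ℝ :=
  Matrix.of fun p q =>
    if p.2 = 0 then (if q.2 = 0 then (M p.1 q.1).re else -(M p.1 q.1).im)
    else (if q.2 = 0 then (M p.1 q.1).im else (M p.1 q.1).re)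

/-- kernel: the realified operator acts as `M` in the coordinates: `cplx (realify M · v) = M · cplx v`. [cite: BalabanImbrieJaffe1988, (4.9) p.275] -/
theorem cplx_realify_mulVec (M : Matrix ι ι ℂ) (v : ι × Fin 2 → ℝ) : cplx (realify M *ᵥ v) = M *ᵥ cplx v := by
  funext i
  apply Complex.ext
  · rw [cplx]
    simp only [mulVec, dotProduct, Complex.re_sum, Complex.mul_re]
    rw [Fintype.sum_prod_type]
    refine sum_congr rfl fun k _ => ?_
    rw [Fin.sum_univ_two, realify, of_apply, of_apply]
    simp only [↓reduceIte, Fin.isValue, one_ne_zero, cplx]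
    ring
  · rw [cplx]
    simp only [mulVec, dotProduct, Complex.im_sum, Complex.mul_im]
    rw [Fintype.sum_prod_type]
    refine sum_congr rfl fun k _ => ?_
    rw [Fin.sum_univ_two, realify, of_apply, of_apply]
    simp only [↓reduceIte, Fin.isValue, one_ne_zero, cplx]
    ring

/-- kernel: the real pairing is the real part of the Hermitian pairing: `v ⬝ w = Re (cplx v)ᴴ(cplx w)`. [cite: BalabanImbrieJaffe1988, (4.9) p.275] -/
theorem dotProduct_eq_re (v w : ι × Fin 2 → ℝ) : v ⬝ᵥ w = (star (cplx v) ⬝ᵥ cplx w).re := by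
  simp only [dotProduct, Complex.re_sum, Pi.star_apply, Complex.star_def, Complex.mul_re, Complex.conj_re, Complex.conj_im]
  rw [Fintype.sum_prod_type]
  refine sum_congr rfl fun i _ => ?_
  rw [Fin.sum_univ_two, cplx, cplx]
  simp only
  ring

/-- **`vᵀ·realify M·w = Re φ_vᴴ M φ_w`**: the quadratic form of the realified matrix is the real part of the Hermitian form.
[cite: BalabanImbrieJaffe1988, (4.9) p.275] -/
theorem dotProduct_realify_mulVec (M : Matrix ι ι ℂ) (v w : ι × Fin 2 → ℝ) :
    v ⬝ᵥ (realify M *ᵥ w) = (star (cplx v) ⬝ᵥ (M *ᵥ cplx w)).re := by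
  rw [dotProduct_eq_re, cplx_realify_mulVec]

omit [Fintype ι] in
/-- **the realification of a Hermitian operator is symmetric**. [cite: BalabanImbrieJaffe1988, (4.9) p.275] -/
theorem realify_isSymm {M : Matrix ι ι ℂ} (hM : M.IsHermitian) : (realify M).IsSymm := by
  ext p q
  obtain ⟨i, a⟩ := p
  obtain ⟨k, b⟩ := q
  have hki : M k i = star (M i k) := by
    have := congrFun (congrFun hM.eq k) i
    rw [conjTranspose_apply] at this
    exact this.symm
  rw [transpose_apply, realify, of_apply, of_apply]
  simp only
  rw [hki, Complex.star_def, Complex.conj_re, Complex.conj_im]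
  fin_cases a <;> fin_cases b <;> simp

/-- **The realified precision matrix of a Hermitian operator with strictly positive form is POSITIVE DEFINITE** — the hypothesis `T.PosDef` of
r18's `Z49_eq`/`log_Z49_sites`. [cite: BalabanImbrieJaffe1988, (4.9) p.275] -/
theorem realify_posDef {M : Matrix ι ι ℂ} (hM : M.IsHermitian) (hpos : ∀ φ : ι → ℂ, φ ≠ 0 → 0 < (star φ ⬝ᵥ (M *ᵥ φ)).re) :
    (realify M).PosDef :=
  posDef_of_isSymm_of_pos (realify_isSymm hM) fun v hv => by
    rw [dotProduct_realify_mulVec]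
    exact hpos _ fun h0 => hv ((cplx_eq_zero_iff v).1 h0)

/-- kernel: two real integration variables per site. [cite: BalabanImbrieJaffe1988, (4.9) p.275] -/
theorem card_idx : Fintype.card (ι × Fin 2) = 2 * Fintype.card ι := by
  rw [Fintype.card_prod, Fintype.card_fin, mul_comm]

end Realify

section Z49Flat

/-- **(4.9) AT A GENERAL STEP `j = k ≥ 1`, FLAT `u`, EVALUATED** (*"Z^{(j)}_{Λ₁₀}(u_k) = ∫𝒟φ_{Λ₁₀} exp(−½⟨Λ₁₀φ,(Δ^{L^jη}_{j,loc}(u_k) +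
aL^{−2}P(u_k))Λ₁₀φ⟩ − E^{(j)}_{k,s}|Λ₁₀|)"*, (4.9) p. 275; *"by (2.38), C^{(k)}_Λ(u)^{−1} is bounded below"*, p. 264): for any
HERMITIAN `Δ` on `ℓ²(T^{(k)})` with the (2.38)-shape bound on the fields supported in `Λ` at the pure gauge `1^{h′}`, `κ ≥ 0`, `γ ≥ 0` and
(2.35)-error `E < c₀(γ, κ)`, the precision matrix `T = realify((Δ + κP(u))|_Λ)` of the Gaussian integral (4.9) (two real coordinates per site of
`Λ`) is positive definite and `Z = e^{−E_sN}·√(2π)^{2|Λ|}/√det T` — r18's `Z49_eq` with its hypothesis `T.PosDef` DISCHARGED (at `j = 0` this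
is r18's `BIJ88Normalization49Torus`; the model-level version is r18's `Z49_eq_of_238`). [cite: BalabanImbrieJaffe1988, (4.9) p.275] -/
theorem Z49_flat_eq (hj : j + 1 ≤ P.m + P.K) (h' : GaugeTransf P j U1)
    {Δ : Matrix (Balaban1983to89.Site P j) (Balaban1983to89.Site P j) ℂ} (hΔ : Δ.IsHermitian) {Λ : Finset (Balaban1983to89.Site P j)}
    {γ E κ : ℝ} (hγ : 0 ≤ γ) (hκ : 0 ≤ κ) (hE : E < c240 P γ κ)
    (h238 : ∀ φ : Balaban1983to89.Site P j → ℂ, (∀ x ∉ Λ, φ x = 0) →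
      γ * ∑ b : PBond P j, ‖toC (h' b.src) * (toC (h' b.tgt))⁻¹ * φ b.tgt - φ b.src‖ ^ 2 - E * ∑ x, ‖φ x‖ ^ 2 ≤
        (star φ ⬝ᵥ (Δ *ᵥ φ)).re) (Es N : ℝ) :
    (realify (compress Λ (op240 Δ κ (gaugeAct h' (1 : GaugeField P j U1))))).PosDef ∧
      Z49 (realify (compress Λ (op240 Δ κ (gaugeAct h' (1 : GaugeField P j U1))))) Es N =
        Real.exp (-(Es * N)) * (Real.sqrt (2 * Real.pi) ^ Fintype.card (↥Λ × Fin 2) /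
          Real.sqrt (realify (compress Λ (op240 Δ κ (gaugeAct h' (1 : GaugeField P j U1))))).det) := by
  have hH : (compress Λ (op240 Δ κ (gaugeAct h' (1 : GaugeField P j U1)))).IsHermitian := by
    show (compress Λ _)ᴴ = compress Λ _
    rw [compress, conjTranspose_submatrix, (op240_isHermitian hΔ κ _).eq]
  have hpos : ∀ v : ↥Λ → ℂ, v ≠ 0 → 0 < (star v ⬝ᵥ (compress Λ (op240 Δ κ (gaugeAct h' (1 : GaugeField P j U1))) *ᵥ v)).re := by
    intro v hv
    rw [star_dotProduct_compress]
    exact re_form_op240_pos hj h' hγ hκ hE h238 (fun x hx => ext0_of_not_mem v hx) fun h0 => hv ((ext0_eq_zero_iff v).1 h0)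
  have hT := realify_posDef hH hpos
  exact ⟨hT, Z49_eq _ hT Es N⟩

/-- **(4.9) in logarithmic form with (4.11) substituted**, at a general step and flat `u`: `log Z = |Λ|·((d−2)log(L^jη) + log 2π) − ½log det T`
(r18's `log_Z49_sites` with `T.PosDef` discharged, `|ι| = 2|Λ|`). [cite: BalabanImbrieJaffe1988, (4.9)–(4.11) p.275] -/
theorem log_Z49_flat_sites (hj : j + 1 ≤ P.m + P.K) (h' : GaugeTransf P j U1)
    {Δ : Matrix (Balaban1983to89.Site P j) (Balaban1983to89.Site P j) ℂ} (hΔ : Δ.IsHermitian) {Λ : Finset (Balaban1983to89.Site P j)}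
    {γ E κ : ℝ} (hγ : 0 ≤ γ) (hκ : 0 ≤ κ) (hE : E < c240 P γ κ)
    (h238 : ∀ φ : Balaban1983to89.Site P j → ℂ, (∀ x ∉ Λ, φ x = 0) →
      γ * ∑ b : PBond P j, ‖toC (h' b.src) * (toC (h' b.tgt))⁻¹ * φ b.tgt - φ b.src‖ ^ 2 - E * ∑ x, ‖φ x‖ ^ 2 ≤
        (star φ ⬝ᵥ (Δ *ᵥ φ)).re) (d : ℕ) (Ljη : ℝ) :
    Real.log (Z49 (realify (compress Λ (op240 Δ κ (gaugeAct h' (1 : GaugeField P j U1))))) (BIJ88Sect4Statements.Eks d Ljη) Λ.card) =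
      (Λ.card : ℝ) * (((d : ℝ) - 2) * Real.log Ljη + Real.log (2 * Real.pi)) -
        (1 / 2 : ℝ) * Real.log (realify (compress Λ (op240 Δ κ (gaugeAct h' (1 : GaugeField P j U1))))).det := by
  have hT := (Z49_flat_eq hj h' hΔ hγ hκ hE h238 0 0).1
  exact log_Z49_sites _ hT d Λ.card Ljη (by rw [card_idx, Fintype.card_coe])

end Z49Flat

/-! ## §6 The located members: (2.39)/(2.40) and (4.9)_{j≥1} AT FLAT `u` FOR GEN 15's CONCRETE `Δ_{k,loc}(1^h)` — this seat's
`ineq238_flat_mult` supplies the (2.38)-shape bound (data hypotheses as there) -/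

section Concrete

open BIJ88NeumannPropagatorFlatDecayCube (cubeT isBlockUnion_cubeT)
open BIJ88Ineq238FlatTorus (ineq238_flat_mult)

variable {d : ℕ}

/-- kernel: the (2.38) conclusion of `ineq238_flat_mult` rearranged into the (2.38)-SHAPE `γ·B(φ) − E·‖φ‖² ≤ Re φᴴΔφ`. [folklore] -/
private theorem shape_of_238 {X B N2 F a238 c238 ak c₁ br : ℝ}
    (h : X / ak * (c238 * B - ak ^ 2 * c₁ * br * N2) ≤ F) (ha238 : a238 = X / ak) :
    a238 * c238 * B - a238 * (ak ^ 2 * c₁ * br) * N2 ≤ F := by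
  rw [ha238]; linarith [h]

/-- **(2.39)/(2.40) AT EVERY PURE-GAUGE BACKGROUND FOR GEN 15's `Δ_{k,loc}(1^h)`** — p02's `Eq240` INHABITED on `ℓ²(Λ)`: under the data
hypotheses of `ineq238_flat_mult` (cubes nested in the box `Ω₀`, `Σ|λ_α| ≤ 1`, `0 ≤ ζ″ ≤ 1`, the (2.35) row hypotheses (i)–(iii) with
multiplicity `m` on every block row of `Λ`, every unit bond meeting `Λ` inside `Ω₀^{(k)*}`), for `Λ ⊆ T^{(k)}` a union of `L`-blocks, the next
lattice existing (`k + 1 ≤ m + K`), `κ = a′L′^{−2} ≥ 0` and the (2.35)-error below the flat Poincaré constant,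
`(A/a_k)·a_k²c₁(m·e^{−2δ₀R/L^k} + e^{−(δ₀/2)R₁/L^k}) < c₀((A/a_k)min(a_k/(8d),½), κ)`:
`C^{(k)}_Λ(1^h) := [(Δ_{k,loc}(1^h) + κQ(u_k)^*Q(u_k))|_Λ]^{−1}` satisfies `Eq240 a′ L′ (Δ_{k,loc}|_Λ) (Q̃|_Λ)^* (Q̃|_Λ) C`, `u_k = 1^{h∘corner_k}` —
p. 264 *"by (2.38), C^{(k)}_Λ(u)^{−1} is bounded below"* made a theorem at flat `u` (in gen 15's counting normalization the printed `aL^{−2}` is `κ = (A/a_k)aL^{−2}`).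
[cite: BalabanImbrieJaffe1988, (2.40) p.264] -/
theorem eq240_deltaLocT_flat (d ℓ : ℕ) (hℓ : 1 ≤ ℓ) {a : ℝ} (ha : 0 < a) :
    ∃ δ₀ c₁ : ℝ, 0 < δ₀ ∧ 0 < c₁ ∧ ∀ (P : Params) (hPd : P.d = d + 1), P.L = ℓ + 1 →
      ∀ k : ℕ, 1 ≤ k → k ≤ P.K → k + 1 ≤ P.m + P.K → ∀ (c M0 : Fin (d + 1) → ℕ), (∀ i, 1 ≤ M0 i) →
        (∀ i, c i * P.L ^ k + P.L ^ k * M0 i ≤ P.sitesPerDir 0) → (∀ i, P.L ^ k * M0 i < P.sitesPerDir 0) →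
      ∀ (ι : Type) [Fintype ι] (cube : ι → Finset (Balaban1983to89.Site P 0))
        (lam : ι → Balaban1983to89.Site P 0 → Balaban1983to89.Site P 0 → ℝ)
        (ζ'' : Balaban1983to89.Site P 0 → Balaban1983to89.Site P 0 → ℝ),
        (∀ α, ∃ t M : Fin (d + 1) → ℕ, (∀ i, 1 ≤ M i) ∧ (∀ i, t i + M i ≤ M0 i) ∧
            cube α = cubeT hPd (P.L ^ k) (c + t) fun i => P.L ^ k * M i) →
        (∀ x y, ∑ α, |lam α x y| ≤ 1) → (∀ x y, 0 ≤ ζ'' x y ∧ ζ'' x y ≤ 1) →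
      ∀ (h : GaugeTransf P 0 U1) (R R₁ : ℝ), 0 ≤ R → 0 ≤ R₁ → ∀ (m : ℕ) (Λ : Finset (Balaban1983to89.Site P (0 + k))),
        IsBlockUnion 1 Λ →
        (∀ y₁ ∈ Λ,
          (∀ x ∈ blockK k y₁, ∀ y, ζ'' x y ≠ 0 → ∑ α, lam α x y = 1) ∧
          (∀ x ∈ blockK k y₁, ∀ α y, ζ'' x y * lam α x y ≠ 0 → x ∈ cube α ∧ y ∈ cube α ∧
              ∀ w ∈ cubeT hPd (P.L ^ k) c (fun i => P.L ^ k * M0 i), w ∉ cube α →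
                R ≤ B5Ineq137Torus.T P 0 x w ∧ R ≤ B5Ineq137Torus.T P 0 y w) ∧
          (∀ x ∈ blockK k y₁, ∀ y, B5Ineq137Torus.T P 0 x y ≤ R₁ → ζ'' x y = 1) ∧
          ∃ S : Finset ι, S.card ≤ m ∧ ∀ x ∈ blockK k y₁, ∀ α y, ζ'' x y * lam α x y ≠ 0 → α ∈ S) →
        (∀ b : PBond P (0 + k), (b.src ∈ Λ ∨ b.tgt ∈ Λ) →
          b ∈ starB (innerK k (cubeT hPd (P.L ^ k) c fun i => P.L ^ k * M0 i))) →
      ∀ (a' L' : ℝ), 0 ≤ a' * L' ^ (-(2 : ℤ)) →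
        (B1RG242Torus.α P a k * (P.L : ℝ) ^ (k * P.d)) / B1.aSeq a P.L k *
            (B1.aSeq a P.L k ^ 2 * c₁ *
              ((m : ℝ) * Real.exp (-(δ₀ * (((P.L : ℝ) ^ k)⁻¹ * (2 * R)))) + Real.exp (-(δ₀ / 2 * (((P.L : ℝ) ^ k)⁻¹ * R₁))))) <
          c240 P ((B1RG242Torus.α P a k * (P.L : ℝ) ^ (k * P.d)) / B1.aSeq a P.L k * min (B1.aSeq a P.L k / (8 * P.d)) (1 / 2))
            (a' * L' ^ (-(2 : ℤ))) →
        Eq240 a' L'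
          (compress Λ (deltaLocT (B1RG242Torus.α P a k * (P.L : ℝ) ^ (k * P.d)) P.eps⁻¹ (gaugeAct h (1 : GaugeField P 0 U1)) k cube lam ζ''))
          (compress Λ (qSq (gaugeAct (fun y => h (cornerIter k y)) (1 : GaugeField P (0 + k) U1)))ᴴ)
          (compress Λ (qSq (gaugeAct (fun y => h (cornerIter k y)) (1 : GaugeField P (0 + k) U1))))
          (compress Λ (op240 (deltaLocT (B1RG242Torus.α P a k * (P.L : ℝ) ^ (k * P.d)) P.eps⁻¹ (gaugeAct h (1 : GaugeField P 0 U1)) k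
            cube lam ζ'') (a' * L' ^ (-(2 : ℤ))) (gaugeAct (fun y => h (cornerIter k y)) (1 : GaugeField P (0 + k) U1))))⁻¹ := by
  obtain ⟨δ₀, c₁, hδ₀, hc₁, H⟩ := ineq238_flat_mult d ℓ hℓ ha
  refine ⟨δ₀, c₁, hδ₀, hc₁, ?_⟩
  intro P hPd hPL k hk1 hkK hk' c M0 hM0 hfit0 hN0 ι _ cube lam ζ hcube hlam hζ h R R₁ hR hR₁ m Λ hΛ hrows hbonds a' L' hκ hsmall
  have hak : 0 < B1.aSeq a P.L k := B1.aSeq_pos ha (B1RG242Torus.one_lt_cast_L P) hk1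
  have hα : 0 < B1RG242Torus.α P a k := mul_pos hak (inv_pos.mpr (pow_pos (P.spacing_pos k) 2))
  have hA : 0 < B1RG242Torus.α P a k * (P.L : ℝ) ^ (k * P.d) := mul_pos hα (pow_pos P.cast_L_pos _)
  have hγ : 0 ≤ (B1RG242Torus.α P a k * (P.L : ℝ) ^ (k * P.d)) / B1.aSeq a P.L k * min (B1.aSeq a P.L k / (8 * P.d)) (1 / 2) := by
    have hd : (0 : ℝ) < P.d := Nat.cast_pos.2 P.hd
    positivity
  have hj : (0 + k) + 1 ≤ P.m + P.K := by omega
  -- the (2.38)-shape bound on the fields supported in Λ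
  have h238 := H P hPd hPL k hk1 hkK c M0 hM0 hfit0 hN0 ι cube lam ζ hcube hlam hζ h R R₁ hR hR₁ m (fun φ => ∀ x ∉ Λ, φ x = 0)
    (fun φ hφ y₁ hy₁ => hrows y₁ (by by_contra hh; exact hy₁ (hφ y₁ hh)))
    (fun φ hφ b hb => hbonds b (hb.imp (fun h1 => by by_contra hh; exact h1 (hφ _ hh)) (fun h1 => by by_contra hh; exact h1 (hφ _ hh))))
  exact eq240_flat hj (fun y => h (cornerIter k y)) hΛ hγ hκ hsmall fun φ hφ => shape_of_238 (h238 φ hφ) rfl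

/-- kernel: the cubes of the data hypothesis are unions of `k`-blocks (they are block-aligned boxes that fit). [cite: BalabanImbrieJaffe1988, (2.27) p.263] -/
private theorem isBlockUnion_of_hcube {P : Params} (hPd : P.d = d + 1) {k : ℕ} (hk : k ≤ P.m + P.K) {c M0 : Fin (d + 1) → ℕ}
    (hfit0 : ∀ i, c i * P.L ^ k + P.L ^ k * M0 i ≤ P.sitesPerDir 0) {ι : Type} {cube : ι → Finset (Balaban1983to89.Site P 0)}
    (hcube : ∀ α, ∃ t M : Fin (d + 1) → ℕ, (∀ i, 1 ≤ M i) ∧ (∀ i, t i + M i ≤ M0 i) ∧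
      cube α = cubeT hPd (P.L ^ k) (c + t) fun i => P.L ^ k * M i) (α : ι) : IsBlockUnion k (cube α) := by
  obtain ⟨t, M, -, htM, hc⟩ := hcube α
  rw [hc]
  refine isBlockUnion_cubeT hPd hk rfl fun i => ?_
  have h1 := hfit0 i; have h2 := htM i
  rw [Pi.add_apply, Nat.add_mul]
  have : t i * P.L ^ k + P.L ^ k * M i ≤ P.L ^ k * M0 i := by
    calc t i * P.L ^ k + P.L ^ k * M i = P.L ^ k * (t i + M i) := by ring
      _ ≤ P.L ^ k * M0 i := Nat.mul_le_mul_left _ h2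
  omega

/-- **(4.9) AT A GENERAL STEP `j = k ≥ 1` AT EVERY PURE-GAUGE BACKGROUND FOR GEN 15's `Δ_{k,loc}(1^h)`** — r18's `Z49_eq` with `T.PosDef`
DISCHARGED: under the hypotheses of `eq240_deltaLocT_flat` and SYMMETRIC data (`λ_α(x,y) = λ_α(y,x)`, `ζ″(x,y) = ζ″(y,x)`, so that `Δ_{k,loc}` is
Hermitian, gen 15's `deltaLocT_conjTranspose`), the precision matrix `T = realify((Δ_{k,loc}(1^h) + κP(u_k))|_Λ)` of the Gaussian integral
(4.9) (two real coordinates per site of `Λ`) is positive definite and `Z^{(k)}_Λ(1^h) = e^{−E_sN}√(2π)^{2|Λ|}/√det T` (r18's cell note «j ≥ 1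
needs the (2.38)/(2.40) positivity of Δ_{j,loc}» — here at flat `u`). [cite: BalabanImbrieJaffe1988, (4.9) p.275] -/
theorem Z49_deltaLocT_flat (d ℓ : ℕ) (hℓ : 1 ≤ ℓ) {a : ℝ} (ha : 0 < a) :
    ∃ δ₀ c₁ : ℝ, 0 < δ₀ ∧ 0 < c₁ ∧ ∀ (P : Params) (hPd : P.d = d + 1), P.L = ℓ + 1 →
      ∀ k : ℕ, 1 ≤ k → k ≤ P.K → k + 1 ≤ P.m + P.K → ∀ (c M0 : Fin (d + 1) → ℕ), (∀ i, 1 ≤ M0 i) →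
        (∀ i, c i * P.L ^ k + P.L ^ k * M0 i ≤ P.sitesPerDir 0) → (∀ i, P.L ^ k * M0 i < P.sitesPerDir 0) →
      ∀ (ι : Type) [Fintype ι] (cube : ι → Finset (Balaban1983to89.Site P 0))
        (lam : ι → Balaban1983to89.Site P 0 → Balaban1983to89.Site P 0 → ℝ)
        (ζ'' : Balaban1983to89.Site P 0 → Balaban1983to89.Site P 0 → ℝ),
        (∀ α, ∃ t M : Fin (d + 1) → ℕ, (∀ i, 1 ≤ M i) ∧ (∀ i, t i + M i ≤ M0 i) ∧
            cube α = cubeT hPd (P.L ^ k) (c + t) fun i => P.L ^ k * M i) →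
        (∀ x y, ∑ α, |lam α x y| ≤ 1) → (∀ x y, 0 ≤ ζ'' x y ∧ ζ'' x y ≤ 1) →
        (∀ α x y, lam α y x = lam α x y) → (∀ x y, ζ'' y x = ζ'' x y) →
      ∀ (h : GaugeTransf P 0 U1) (R R₁ : ℝ), 0 ≤ R → 0 ≤ R₁ → ∀ (m : ℕ) (Λ : Finset (Balaban1983to89.Site P (0 + k))),
        (∀ y₁ ∈ Λ,
          (∀ x ∈ blockK k y₁, ∀ y, ζ'' x y ≠ 0 → ∑ α, lam α x y = 1) ∧
          (∀ x ∈ blockK k y₁, ∀ α y, ζ'' x y * lam α x y ≠ 0 → x ∈ cube α ∧ y ∈ cube α ∧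
              ∀ w ∈ cubeT hPd (P.L ^ k) c (fun i => P.L ^ k * M0 i), w ∉ cube α →
                R ≤ B5Ineq137Torus.T P 0 x w ∧ R ≤ B5Ineq137Torus.T P 0 y w) ∧
          (∀ x ∈ blockK k y₁, ∀ y, B5Ineq137Torus.T P 0 x y ≤ R₁ → ζ'' x y = 1) ∧
          ∃ S : Finset ι, S.card ≤ m ∧ ∀ x ∈ blockK k y₁, ∀ α y, ζ'' x y * lam α x y ≠ 0 → α ∈ S) →
        (∀ b : PBond P (0 + k), (b.src ∈ Λ ∨ b.tgt ∈ Λ) →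
          b ∈ starB (innerK k (cubeT hPd (P.L ^ k) c fun i => P.L ^ k * M0 i))) →
      ∀ (κ : ℝ), 0 ≤ κ →
        (B1RG242Torus.α P a k * (P.L : ℝ) ^ (k * P.d)) / B1.aSeq a P.L k *
            (B1.aSeq a P.L k ^ 2 * c₁ *
              ((m : ℝ) * Real.exp (-(δ₀ * (((P.L : ℝ) ^ k)⁻¹ * (2 * R)))) + Real.exp (-(δ₀ / 2 * (((P.L : ℝ) ^ k)⁻¹ * R₁))))) <
          c240 P ((B1RG242Torus.α P a k * (P.L : ℝ) ^ (k * P.d)) / B1.aSeq a P.L k * min (B1.aSeq a P.L k / (8 * P.d)) (1 / 2)) κ →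
      ∀ (Es N : ℝ),
        (realify (compress Λ (op240 (deltaLocT (B1RG242Torus.α P a k * (P.L : ℝ) ^ (k * P.d)) P.eps⁻¹ (gaugeAct h (1 : GaugeField P 0 U1)) k
            cube lam ζ'') κ (gaugeAct (fun y => h (cornerIter k y)) (1 : GaugeField P (0 + k) U1))))).PosDef ∧
        Z49 (realify (compress Λ (op240 (deltaLocT (B1RG242Torus.α P a k * (P.L : ℝ) ^ (k * P.d)) P.eps⁻¹ (gaugeAct h (1 : GaugeField P 0 U1)) k
            cube lam ζ'') κ (gaugeAct (fun y => h (cornerIter k y)) (1 : GaugeField P (0 + k) U1))))) Es N =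
          Real.exp (-(Es * N)) * (Real.sqrt (2 * Real.pi) ^ Fintype.card (↥Λ × Fin 2) /
            Real.sqrt (realify (compress Λ (op240 (deltaLocT (B1RG242Torus.α P a k * (P.L : ℝ) ^ (k * P.d)) P.eps⁻¹
              (gaugeAct h (1 : GaugeField P 0 U1)) k cube lam ζ'') κ (gaugeAct (fun y => h (cornerIter k y)) (1 : GaugeField P (0 + k) U1))))).det) := by
  obtain ⟨δ₀, c₁, hδ₀, hc₁, H⟩ := ineq238_flat_mult d ℓ hℓ ha
  refine ⟨δ₀, c₁, hδ₀, hc₁, ?_⟩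
  intro P hPd hPL k hk1 hkK hk' c M0 hM0 hfit0 hN0 ι _ cube lam ζ hcube hlam hζ hlamS hζS h R R₁ hR hR₁ m Λ hrows hbonds κ hκ hsmall Es N
  have hak : 0 < B1.aSeq a P.L k := B1.aSeq_pos ha (B1RG242Torus.one_lt_cast_L P) hk1
  have hα : 0 < B1RG242Torus.α P a k := mul_pos hak (inv_pos.mpr (pow_pos (P.spacing_pos k) 2))
  have hA : 0 < B1RG242Torus.α P a k * (P.L : ℝ) ^ (k * P.d) := mul_pos hα (pow_pos P.cast_L_pos _)
  have hγ : 0 ≤ (B1RG242Torus.α P a k * (P.L : ℝ) ^ (k * P.d)) / B1.aSeq a P.L k * min (B1.aSeq a P.L k / (8 * P.d)) (1 / 2) := by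
    have hd : (0 : ℝ) < P.d := Nat.cast_pos.2 P.hd
    positivity
  have hj : (0 + k) + 1 ≤ P.m + P.K := by omega
  have hk : 0 + k ≤ P.m + P.K := by omega
  have h238 := H P hPd hPL k hk1 hkK c M0 hM0 hfit0 hN0 ι cube lam ζ hcube hlam hζ h R R₁ hR hR₁ m (fun φ => ∀ x ∉ Λ, φ x = 0)
    (fun φ hφ y₁ hy₁ => hrows y₁ (by by_contra hh; exact hy₁ (hφ y₁ hh)))
    (fun φ hφ b hb => hbonds b (hb.imp (fun h1 => by by_contra hh; exact h1 (hφ _ hh)) (fun h1 => by by_contra hh; exact h1 (hφ _ hh))))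
  have hΔ : (deltaLocT (B1RG242Torus.α P a k * (P.L : ℝ) ^ (k * P.d)) P.eps⁻¹ (gaugeAct h (1 : GaugeField P 0 U1)) k cube lam ζ).IsHermitian :=
    deltaLocT_conjTranspose hk (inv_ne_zero P.eps_pos.ne') hA (gaugeAct h 1) (isBlockUnion_of_hcube hPd (by omega) hfit0 hcube) hlamS hζS
  exact Z49_flat_eq hj (fun y => h (cornerIter k y)) hΔ hγ hκ hsmall (fun φ hφ => shape_of_238 (h238 φ hφ) rfl) Es N

end Concrete

end

end Literature.MathematicalPhysics.QuantumFieldTheory.BalabanImbrieJaffe1984to88.BIJ88Eq240FlatTorus
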